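import Summits.CriticalPhenomena.PercolationContinuityZ3.Theorems.PercNearOneGluingNoHeavyLowerTailMajorityGluingQCertSym3Fast
import HarnessLib

/-!
# Cubic orbit keys from VENN COUNT VECTORS (towards the type-space checker; lane prim-rate, constants-miner 1, gen 37 → 38; census/g37/TYPE-SPACE-CHECKER.md)

Support file for the closed crux `NoHeavyLowerTail` (stmt-CriticalPhenomena-4575), majority-gluing line.  Step 1 of the type-space checker: the orbit key of a cubic
monomial `x_i x_j x_k` depends only on the VENN COUNT VECTOR of the ordered triple — `ccnt m i j k v = #{x < m : 4[x∈i] + 2[x∈j] + [x∈k] = v}`, `v = 1 … 7` — and on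
which slots are the variable `δ` (index `2^m`): the seven popcounts feeding `keyT` are sums of cell counts (`popc_eq_ccnt_*`), so **`keyT m i j k =
keyOfCounts m [i = 2^m] [j = 2^m] [k = 2^m] (ccnt … 1) … (ccnt … 7)`** for indices `< 2^m + 1` (`keyT_eq_keyOfCounts`).  Step 2 (the counting lemma: the number of index
pairs in a cylinder product with a given count vector is a product formula) and step 3 (the checker) follow in gen 38.  Pure `Nat`/list arithmetic; no sorries.
-/

namespace Summit.CriticalPhenomena.PercolationContinuityZ3.Theorems

namespace HubOnly
namespace QCert

/-! ### Venn cells and their counts -/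

/-- The Venn cell of relay `x` w.r.t. the ordered triple `(i, j, k)`: `4[x∈i] + 2[x∈j] + [x∈k]`. -/
def cell (i j k x : ℕ) : ℕ := (cond (tb i x) 4 0 + cond (tb j x) 2 0) + cond (tb k x) 1 0

/-- The number of relays `x < m` in Venn cell `v`. -/
def ccnt (m i j k v : ℕ) : ℕ := cnt m fun x => cell i j k x == v

section Counts
variable (m i j k : ℕ)

/-- `|i| = c₄ + c₅ + c₆ + c₇`. -/
theorem popc_eq_ccnt_i : popc m i = ccnt m i j k 4 + ccnt m i j k 5 + ccnt m i j k 6 + ccnt m i j k 7 := by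
  rw [popc_eq_cnt, cnt_split m (fun x => tb i x) (fun x => tb j x), cnt_split m (fun x => tb i x && tb j x) (fun x => tb k x),
    cnt_split m (fun x => tb i x && !(tb j x)) (fun x => tb k x)]
  unfold ccnt cell
  have e7 := cnt_congr m (P := fun x => (tb i x && tb j x) && tb k x) (Q := fun x => ((cond (tb i x) 4 0 + cond (tb j x) 2 0) + cond (tb k x) 1 0 == 7))
    (fun x => by cases tb i x <;> cases tb j x <;> cases tb k x <;> rfl)
  have e6 := cnt_congr m (P := fun x => (tb i x && tb j x) && !(tb k x)) (Q := fun x => ((cond (tb i x) 4 0 + cond (tb j x) 2 0) + cond (tb k x) 1 0 == 6))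
    (fun x => by cases tb i x <;> cases tb j x <;> cases tb k x <;> rfl)
  have e5 := cnt_congr m (P := fun x => (tb i x && !(tb j x)) && tb k x) (Q := fun x => ((cond (tb i x) 4 0 + cond (tb j x) 2 0) + cond (tb k x) 1 0 == 5))
    (fun x => by cases tb i x <;> cases tb j x <;> cases tb k x <;> rfl)
  have e4 := cnt_congr m (P := fun x => (tb i x && !(tb j x)) && !(tb k x)) (Q := fun x => ((cond (tb i x) 4 0 + cond (tb j x) 2 0) + cond (tb k x) 1 0 == 4))
    (fun x => by cases tb i x <;> cases tb j x <;> cases tb k x <;> rfl)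
  rw [e7, e6, e5, e4]; ring

/-- `|j| = c₂ + c₃ + c₆ + c₇`. -/
theorem popc_eq_ccnt_j : popc m j = ccnt m i j k 2 + ccnt m i j k 3 + ccnt m i j k 6 + ccnt m i j k 7 := by
  rw [popc_eq_cnt, cnt_split m (fun x => tb j x) (fun x => tb i x), cnt_split m (fun x => tb j x && tb i x) (fun x => tb k x),
    cnt_split m (fun x => tb j x && !(tb i x)) (fun x => tb k x)]
  unfold ccnt cell
  have e7 := cnt_congr m (P := fun x => (tb j x && tb i x) && tb k x) (Q := fun x => ((cond (tb i x) 4 0 + cond (tb j x) 2 0) + cond (tb k x) 1 0 == 7))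
    (fun x => by cases tb i x <;> cases tb j x <;> cases tb k x <;> rfl)
  have e6 := cnt_congr m (P := fun x => (tb j x && tb i x) && !(tb k x)) (Q := fun x => ((cond (tb i x) 4 0 + cond (tb j x) 2 0) + cond (tb k x) 1 0 == 6))
    (fun x => by cases tb i x <;> cases tb j x <;> cases tb k x <;> rfl)
  have e3 := cnt_congr m (P := fun x => (tb j x && !(tb i x)) && tb k x) (Q := fun x => ((cond (tb i x) 4 0 + cond (tb j x) 2 0) + cond (tb k x) 1 0 == 3))
    (fun x => by cases tb i x <;> cases tb j x <;> cases tb k x <;> rfl)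
  have e2 := cnt_congr m (P := fun x => (tb j x && !(tb i x)) && !(tb k x)) (Q := fun x => ((cond (tb i x) 4 0 + cond (tb j x) 2 0) + cond (tb k x) 1 0 == 2))
    (fun x => by cases tb i x <;> cases tb j x <;> cases tb k x <;> rfl)
  rw [e7, e6, e3, e2]; ring

/-- `|k| = c₁ + c₃ + c₅ + c₇`. -/
theorem popc_eq_ccnt_k : popc m k = ccnt m i j k 1 + ccnt m i j k 3 + ccnt m i j k 5 + ccnt m i j k 7 := by
  rw [popc_eq_cnt, cnt_split m (fun x => tb k x) (fun x => tb i x), cnt_split m (fun x => tb k x && tb i x) (fun x => tb j x),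
    cnt_split m (fun x => tb k x && !(tb i x)) (fun x => tb j x)]
  unfold ccnt cell
  have e7 := cnt_congr m (P := fun x => (tb k x && tb i x) && tb j x) (Q := fun x => ((cond (tb i x) 4 0 + cond (tb j x) 2 0) + cond (tb k x) 1 0 == 7))
    (fun x => by cases tb i x <;> cases tb j x <;> cases tb k x <;> rfl)
  have e5 := cnt_congr m (P := fun x => (tb k x && tb i x) && !(tb j x)) (Q := fun x => ((cond (tb i x) 4 0 + cond (tb j x) 2 0) + cond (tb k x) 1 0 == 5))
    (fun x => by cases tb i x <;> cases tb j x <;> cases tb k x <;> rfl)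
  have e3 := cnt_congr m (P := fun x => (tb k x && !(tb i x)) && tb j x) (Q := fun x => ((cond (tb i x) 4 0 + cond (tb j x) 2 0) + cond (tb k x) 1 0 == 3))
    (fun x => by cases tb i x <;> cases tb j x <;> cases tb k x <;> rfl)
  have e1 := cnt_congr m (P := fun x => (tb k x && !(tb i x)) && !(tb j x)) (Q := fun x => ((cond (tb i x) 4 0 + cond (tb j x) 2 0) + cond (tb k x) 1 0 == 1))
    (fun x => by cases tb i x <;> cases tb j x <;> cases tb k x <;> rfl)
  rw [e7, e5, e3, e1]; ring

/-- `|i ∧ j| = c₆ + c₇`. -/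
theorem popc_eq_ccnt_ij : popc m (i &&& j) = ccnt m i j k 6 + ccnt m i j k 7 := by
  have h0 : popc m (i &&& j) = cnt m fun x => tb i x && tb j x := cnt_congr m fun x => tb_and i j x
  rw [h0, cnt_split m (fun x => tb i x && tb j x) (fun x => tb k x)]
  unfold ccnt cell
  have e7 := cnt_congr m (P := fun x => (tb i x && tb j x) && tb k x) (Q := fun x => ((cond (tb i x) 4 0 + cond (tb j x) 2 0) + cond (tb k x) 1 0 == 7))
    (fun x => by cases tb i x <;> cases tb j x <;> cases tb k x <;> rfl)
  have e6 := cnt_congr m (P := fun x => (tb i x && tb j x) && !(tb k x)) (Q := fun x => ((cond (tb i x) 4 0 + cond (tb j x) 2 0) + cond (tb k x) 1 0 == 6))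
    (fun x => by cases tb i x <;> cases tb j x <;> cases tb k x <;> rfl)
  rw [e7, e6]; ring

/-- `|i ∧ k| = c₅ + c₇`. -/
theorem popc_eq_ccnt_ik : popc m (i &&& k) = ccnt m i j k 5 + ccnt m i j k 7 := by
  have h0 : popc m (i &&& k) = cnt m fun x => tb i x && tb k x := cnt_congr m fun x => tb_and i k x
  rw [h0, cnt_split m (fun x => tb i x && tb k x) (fun x => tb j x)]
  unfold ccnt cell
  have e7 := cnt_congr m (P := fun x => (tb i x && tb k x) && tb j x) (Q := fun x => ((cond (tb i x) 4 0 + cond (tb j x) 2 0) + cond (tb k x) 1 0 == 7))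
    (fun x => by cases tb i x <;> cases tb j x <;> cases tb k x <;> rfl)
  have e5 := cnt_congr m (P := fun x => (tb i x && tb k x) && !(tb j x)) (Q := fun x => ((cond (tb i x) 4 0 + cond (tb j x) 2 0) + cond (tb k x) 1 0 == 5))
    (fun x => by cases tb i x <;> cases tb j x <;> cases tb k x <;> rfl)
  rw [e7, e5]; ring

/-- `|j ∧ k| = c₃ + c₇`. -/
theorem popc_eq_ccnt_jk : popc m (j &&& k) = ccnt m i j k 3 + ccnt m i j k 7 := by
  have h0 : popc m (j &&& k) = cnt m fun x => tb j x && tb k x := cnt_congr m fun x => tb_and j k x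
  rw [h0, cnt_split m (fun x => tb j x && tb k x) (fun x => tb i x)]
  unfold ccnt cell
  have e7 := cnt_congr m (P := fun x => (tb j x && tb k x) && tb i x) (Q := fun x => ((cond (tb i x) 4 0 + cond (tb j x) 2 0) + cond (tb k x) 1 0 == 7))
    (fun x => by cases tb i x <;> cases tb j x <;> cases tb k x <;> rfl)
  have e3 := cnt_congr m (P := fun x => (tb j x && tb k x) && !(tb i x)) (Q := fun x => ((cond (tb i x) 4 0 + cond (tb j x) 2 0) + cond (tb k x) 1 0 == 3))
    (fun x => by cases tb i x <;> cases tb j x <;> cases tb k x <;> rfl)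
  rw [e7, e3]; ring

/-- `|i ∧ j ∧ k| = c₇`. -/
theorem popc_eq_ccnt_ijk : popc m (i &&& j &&& k) = ccnt m i j k 7 := by
  have h1 : popc m (i &&& j &&& k) = cnt m fun x => (tb i x && tb j x) && tb k x := cnt_congr m fun x => by rw [tb_and, tb_and]
  rw [h1]
  unfold ccnt cell
  exact cnt_congr m fun x => by cases tb i x <;> cases tb j x <;> cases tb k x <;> rfl

end Counts

/-! ### The key from the counts -/

/-- `canonTc` only reads «is the slot below `2^m`» and, if not, the slot itself. -/
theorem canonTc_slots (m a b c a' b' c' pa pb pc pab pac pbc pabc : ℕ)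
    (ha : (a < 2 ^ m ↔ a' < 2 ^ m) ∧ (¬ a < 2 ^ m → a = a')) (hb : (b < 2 ^ m ↔ b' < 2 ^ m) ∧ (¬ b < 2 ^ m → b = b'))
    (hc : (c < 2 ^ m ↔ c' < 2 ^ m) ∧ (¬ c < 2 ^ m → c = c')) :
    canonTc m a b c pa pb pc pab pac pbc pabc = canonTc m a' b' c' pa pb pc pab pac pbc pabc := by
  have hA : ∀ X : ℕ, (if a < 2 ^ m then X else a) = (if a' < 2 ^ m then X else a') := fun X => by
    by_cases h : a < 2 ^ m
    · rw [if_pos h, if_pos (ha.1.mp h)]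
    · rw [if_neg h, if_neg (fun h' => h (ha.1.mpr h')), ha.2 h]
  have hB : ∀ X : ℕ, (if b < 2 ^ m then X else b) = (if b' < 2 ^ m then X else b') := fun X => by
    by_cases h : b < 2 ^ m
    · rw [if_pos h, if_pos (hb.1.mp h)]
    · rw [if_neg h, if_neg (fun h' => h (hb.1.mpr h')), hb.2 h]
  have hC : ∀ X : ℕ, (if c < 2 ^ m then X else c) = (if c' < 2 ^ m then X else c') := fun X => by
    by_cases h : c < 2 ^ m
    · rw [if_pos h, if_pos (hc.1.mp h)]
    · rw [if_neg h, if_neg (fun h' => h (hc.1.mpr h')), hc.2 h]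
  unfold canonTc
  simp only [hA, hB, hC]

/-- The stand-in slot value for a D-flag: `2^m` for the variable `δ`, `0` for a pattern. -/
def slotOf (m : ℕ) (d : Bool) : ℕ := cond d (2 ^ m) 0

/-- **The orbit key from the Venn counts and the D-flags** (the arithmetic of `keyT` with the popcounts written as cell-count sums). -/
def keyOfCounts (m : ℕ) (di dj dk : Bool) (c1 c2 c3 c4 c5 c6 c7 : ℕ) : ℕ :=
  let i := slotOf m di
  let j := slotOf m dj
  let k := slotOf m dk
  let pi := c4 + c5 + c6 + c7
  let pj := c2 + c3 + c6 + c7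
  let pk := c1 + c3 + c5 + c7
  let pij := c6 + c7
  let pik := c5 + c7
  let pjk := c3 + c7
  let pijk := c7
  let si := (2 * m + 1) * pi + (pij + pik)
  let sj := (2 * m + 1) * pj + (pij + pjk)
  let sk := (2 * m + 1) * pk + (pik + pjk)
  if sj ≤ si then
    (if sk ≤ sj then canonTc m i j k pi pj pk pij pik pjk pijk
     else if sk ≤ si then canonTc m i k j pi pk pj pik pij pjk pijk
     else canonTc m k i j pk pi pj pik pjk pij pijk)
  else
    (if sk ≤ si then canonTc m j i k pj pi pk pij pjk pik pijk
     else if sk ≤ sj then canonTc m j k i pj pk pi pjk pij pik pijk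
     else canonTc m k j i pk pj pi pjk pik pij pijk)

/-- A slot below `2^m + 1` and its stand-in agree on «below `2^m`», and are equal otherwise. -/
theorem slotOf_spec (m a : ℕ) (ha : a < 2 ^ m + 1) :
    (a < 2 ^ m ↔ slotOf m (a == 2 ^ m) < 2 ^ m) ∧ (¬ a < 2 ^ m → a = slotOf m (a == 2 ^ m)) := by
  unfold slotOf
  by_cases h : a = 2 ^ m
  · subst h; simp
  · have hlt : a < 2 ^ m := by omega
    have hne : (a == 2 ^ m) = false := by simp [h]
    rw [hne]; simp [hlt, Nat.two_pow_pos m]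

/-- **`keyT` from the counts**: for indices below `2^m + 1` the orbit key is `keyOfCounts` of the Venn count vector and the D-flags. -/
theorem keyT_eq_keyOfCounts (m i j k : ℕ) (hi : i < 2 ^ m + 1) (hj : j < 2 ^ m + 1) (hk : k < 2 ^ m + 1) :
    keyT m i j k = keyOfCounts m (i == 2 ^ m) (j == 2 ^ m) (k == 2 ^ m)
      (ccnt m i j k 1) (ccnt m i j k 2) (ccnt m i j k 3) (ccnt m i j k 4) (ccnt m i j k 5) (ccnt m i j k 6) (ccnt m i j k 7) := by
  have si := slotOf_spec m i hi
  have sj := slotOf_spec m j hj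
  have sk := slotOf_spec m k hk
  unfold keyT keyOfCounts
  simp only [popcT_eq, popc_eq_ccnt_i m i j k, popc_eq_ccnt_j m i j k, popc_eq_ccnt_k m i j k, popc_eq_ccnt_ij m i j k,
    popc_eq_ccnt_ik m i j k, popc_eq_ccnt_jk m i j k, popc_eq_ccnt_ijk m i j k]
  split_ifs
  · exact canonTc_slots m _ _ _ _ _ _ _ _ _ _ _ _ _ si sj sk
  · exact canonTc_slots m _ _ _ _ _ _ _ _ _ _ _ _ _ si sk sj
  · exact canonTc_slots m _ _ _ _ _ _ _ _ _ _ _ _ _ sk si sj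
  · exact canonTc_slots m _ _ _ _ _ _ _ _ _ _ _ _ _ sj si sk
  · exact canonTc_slots m _ _ _ _ _ _ _ _ _ _ _ _ _ sj sk si
  · exact canonTc_slots m _ _ _ _ _ _ _ _ _ _ _ _ _ sk sj si

/-- Sanity (kernel): the counts route reproduces `keyT` on sample triples at `m = 3` and `m = 10`. -/
theorem keyOfCounts_examples :
    keyT 3 5 3 8 = keyOfCounts 3 false false true (ccnt 3 5 3 8 1) (ccnt 3 5 3 8 2) (ccnt 3 5 3 8 3) (ccnt 3 5 3 8 4) (ccnt 3 5 3 8 5) (ccnt 3 5 3 8 6) (ccnt 3 5 3 8 7) ∧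
    keyT 10 837 1024 395 = keyOfCounts 10 false true false (ccnt 10 837 1024 395 1) (ccnt 10 837 1024 395 2) (ccnt 10 837 1024 395 3) (ccnt 10 837 1024 395 4)
      (ccnt 10 837 1024 395 5) (ccnt 10 837 1024 395 6) (ccnt 10 837 1024 395 7) := by
  decide +kernel

end QCert
end HubOnly

end Summit.CriticalPhenomena.PercolationContinuityZ3.Theorems
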